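import Summits.BirchSwinnertonDyer.BirchSwinnertonDyer.Theorems.PrintX6Assembly
import Summits.BirchSwinnertonDyer.BirchSwinnertonDyer.Theorems.PrintX6UpperHalfX6
import Literature.NumberTheory.EllipticCurves.Wuthrich2014.ThreeAdicImageSupersingularProofs
import HarnessLib

/-!
# Route `PrintX6`: the leaf `WAllCornerX6r0` is EQUIVALENT, over eight refereed inputs, to the two
# Eisenstein-half value-cell statements — and the ninth input (Wuthrich 2014 Lemma 20) is a tree theorem

HONEST FRAMING (cell `bsd-print-x6`, run/shared/lean/pub/bsd-print-x6/; PRINT tier D-0131 (2);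
prover p2). THEOREMS ONLY; bookkeeping over the route's items and landed theorems; nothing about any
particular curve is asserted; BSD is not proved by any of this; the two cruxes `EisensteinHalfFiveLe`
(stmt-20276) and `EisensteinHalfAtThree` (stmt-20285) stay OPEN.

What is recorded (all by name):
* the route's support item `PublishedInputsX6` (stmt-20302, a nine-fold conjunction of named facts)
  follows from EIGHT of them (`publishedInputsX6_of_facts` in `PrintX6PublishedInputsOfParts.lean`,
  glue item stmt-20376 PROVED; inlined here): its sixth conjunct, Wuthrich 2014 Lemma 20, is a tree theorem
  (`Wuthrich2014.lemma20_surjective_threeAdic_of_semistable_holds`). The eight that remain: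
  Kobayashi 2003 Thm. 1.2, Thm. 4.1; B. D. Kim 2013 Cor. 3.15; the period-unit facts at `p ≥ 5` and
  at `3` (Greenberg–Vatsal 2000 Rem. 3.4 / Abbes–Ullmo / Mazur / Edixhoven); modularity
  (parametrisation data; entire `L`-function); GZK.
* `wallCornerX6r0_of_inputs_of_eisensteinHalves` — the leaf from the eight inputs and the two
  Eisenstein halves (`printX6_assembly_proof` ∘ `upperHalfX6_proof`, items Assembly stmt-20303 and
  UpperHalfX6 stmt-20301, both PROVED).
* `eisensteinHalfFiveLe_of_wallCornerX6r0`, `eisensteinHalfAtThree_of_wallCornerX6r0` — conversely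
  the leaf gives back both halves (GZK for the finiteness of `Ш`; `Typed.missingPPartAt_of_bsdp`), so
* `wallCornerX6r0_iff_eisensteinHalves` — **over the eight inputs, `WAllCornerX6r0 ↔
  EisensteinHalfFiveLe ∧ EisensteinHalfAtThree`**: the route's two cruxes are EXACTLY the leaf's
  deficit, no more and no less; the unit cells carry no deficit.
[cite: Wuthrich2014, Lemma 20 (p. 399)] [cite: Kobayashi2003, Thm. 1.2 (p. 2) and Thm. 4.1 (p. 8)]
[cite: BDKim2013, Cor. 3.15 (p. 199)] [cite: Miller2011LMS, §1 and Def. 1.1]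
-/

set_option autoImplicit false
-- the landed namespace `Summit.BirchSwinnertonDyer.BirchSwinnertonDyer.Theorems` (summit = problem) trips the linter
set_option linter.dupNamespace false

noncomputable section

open scoped Classical

open WeierstrassCurve Literature.NumberTheory.EllipticCurves
  Literature.NumberTheory.EllipticCurves.ModularForms
  Literature.NumberTheory.EllipticCurves.Rank1Residual
  Literature.NumberTheory.EllipticCurves.Rank1Residual.Typed
  Summit.BirchSwinnertonDyer.BirchSwinnertonDyer.Theses.PrintX6

namespace Summit.BirchSwinnertonDyer.BirchSwinnertonDyer.Theorems

/-- **The leaf from the eight inputs and the two Eisenstein halves** (items Assembly and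
UpperHalfX6 are PROVED: `printX6_assembly_proof`, `upperHalfX6_proof`).
[cite: Kobayashi2003, Thm. 4.1 (p. 8)] [cite: BDKim2013, Cor. 3.15 (p. 199)] [cite: Miller2011LMS, §1 and Def. 1.1] -/
theorem wallCornerX6r0_of_inputs_of_eisensteinHalves
    (h12 : Kobayashi2003.thm12_signedSelmerDual_finite_torsion)
    (h41 : Kobayashi2003.thm41_signedCharIdeal_divisibility)
    (hKim : BDKim2013.cor315_signedCharValue_rankZero)
    (h5 : realPeriodRat_eq_unit_mul_plusPeriod) (h3 : realPeriodRat_eq_unit_mul_plusPeriod_three)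
    (hmod : nonempty_modularParametrizationData) (hmod' : hasEntireLFunction_rat)
    (hGZK : rank_eq_analyticRank_of_analyticRank_le_one)
    (hE5 : EisensteinHalfFiveLe) (hE3 : EisensteinHalfAtThree) :
    Summit.BirchSwinnertonDyer.WAllCornerX6r0 :=
  printX6_assembly_proof
    ⟨h12, h41, hKim, h5, h3, Wuthrich2014.lemma20_surjective_threeAdic_of_semistable_holds, hmod, hmod',
      hGZK⟩ upperHalfX6_proof hE5 hE3

/-- **Conversely the leaf gives the `p ≥ 5` Eisenstein half** (GZK for `Ш` finite; `BSD(E,p)` ⇒ the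
whole typed output `MissingPPartAt`, whose rational is the unique value of `#Ш_an`).
[cite: Miller2011LMS, Def. 1.1] -/
theorem eisensteinHalfFiveLe_of_wallCornerX6r0 (hGZK : rank_eq_analyticRank_of_analyticRank_le_one)
    (h : Summit.BirchSwinnertonDyer.WAllCornerX6r0) : EisensteinHalfFiveLe := by
  intro W _ _ p _ hcm hp5 hX h0 q hq _
  have hB : BSDp W p := h W p hcm (by omega) hX h0
  haveI : Finite W.sha := (hGZK W (by omega)).2
  obtain ⟨q', hq', hv⟩ := missingPPartAt_of_bsdp W p hB
  have hqq : q' = q := by exact_mod_cast hq'.symm.trans hq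
  subst hqq
  exact hv.le

/-- **Conversely the leaf gives the `p = 3` Eisenstein half.** [cite: Miller2011LMS, Def. 1.1] -/
theorem eisensteinHalfAtThree_of_wallCornerX6r0 (hGZK : rank_eq_analyticRank_of_analyticRank_le_one)
    (h : Summit.BirchSwinnertonDyer.WAllCornerX6r0) : EisensteinHalfAtThree := by
  intro W _ _ p _ hcm hp3 hX h0 q hq _
  have hB : BSDp W p := h W p hcm (by omega) hX h0
  haveI : Finite W.sha := (hGZK W (by omega)).2
  obtain ⟨q', hq', hv⟩ := missingPPartAt_of_bsdp W p hB
  have hqq : q' = q := by exact_mod_cast hq'.symm.trans hq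
  subst hqq
  exact hv.le

/-- **Over the eight refereed inputs the leaf A6 is EQUIVALENT to the two Eisenstein-half value-cell
statements**: `WAllCornerX6r0 ↔ EisensteinHalfFiveLe ∧ EisensteinHalfAtThree`. The route's cruxes
are exactly the leaf's deficit; the unit cells (and the whole upper half) carry none.
[cite: Kobayashi2003, Thm. 4.1 (p. 8)] [cite: BDKim2013, Cor. 3.15 (p. 199)] [cite: Miller2011LMS, §1 and Def. 1.1] -/
theorem wallCornerX6r0_iff_eisensteinHalves
    (h12 : Kobayashi2003.thm12_signedSelmerDual_finite_torsion)
    (h41 : Kobayashi2003.thm41_signedCharIdeal_divisibility)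
    (hKim : BDKim2013.cor315_signedCharValue_rankZero)
    (h5 : realPeriodRat_eq_unit_mul_plusPeriod) (h3 : realPeriodRat_eq_unit_mul_plusPeriod_three)
    (hmod : nonempty_modularParametrizationData) (hmod' : hasEntireLFunction_rat)
    (hGZK : rank_eq_analyticRank_of_analyticRank_le_one) :
    Summit.BirchSwinnertonDyer.WAllCornerX6r0 ↔ (EisensteinHalfFiveLe ∧ EisensteinHalfAtThree) :=
  ⟨fun h ↦ ⟨eisensteinHalfFiveLe_of_wallCornerX6r0 hGZK h, eisensteinHalfAtThree_of_wallCornerX6r0 hGZK h⟩,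
    fun h ↦ wallCornerX6r0_of_inputs_of_eisensteinHalves h12 h41 hKim h5 h3 hmod hmod' hGZK h.1 h.2⟩

/-- **Route currency**: `PublishedInputsX6 → (WAllCornerX6r0 ↔ EisensteinHalfFiveLe ∧
EisensteinHalfAtThree)`. [cite: Miller2011LMS, §1 and Def. 1.1] -/
theorem wallCornerX6r0_iff_eisensteinHalves_of_publishedInputsX6 (hPub : PublishedInputsX6) :
    Summit.BirchSwinnertonDyer.WAllCornerX6r0 ↔ (EisensteinHalfFiveLe ∧ EisensteinHalfAtThree) :=
  ⟨fun h ↦ ⟨eisensteinHalfFiveLe_of_wallCornerX6r0 hPub.2.2.2.2.2.2.2.2 h,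
      eisensteinHalfAtThree_of_wallCornerX6r0 hPub.2.2.2.2.2.2.2.2 h⟩,
    fun h ↦ printX6_assembly_proof hPub upperHalfX6_proof h.1 h.2⟩

end Summit.BirchSwinnertonDyer.BirchSwinnertonDyer.Theorems

end
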